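import Literature.NumberTheory.GaloisRepresentations.IdeleBrauerLocalInvariantsDictionary
import Literature.NumberTheory.GaloisCohomology.CyclicClassLocalNorm
import Literature.NumberTheory.GaloisCohomology.PoitouTateNumberField
import Literature.AnabelianGeometry.AbsoluteAnabelian.AbsAnabProp121viiBrauerTorsionProofs
import Literature.Algebra.Homology.TateNakayamaCupProductInflation
import HarnessLib

/-!
# Tate's reciprocity law at a finite layer: the local invariants of a relative Brauer class sum to zero,
# `inv (H²(Eˣ → J_E) β) = 0` (Cassels–Fröhlich VII §11.2 (bis); Neukirch–Schmidt–Wingberg (8.1.17))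

Topic `NumberTheory/GaloisRepresentations`; namespace `Literature.NumberTheory.GaloisRepresentations.IdeleCohomology`
(continuing door-c5's `IdeleLocalInvariants*`: `inv E = Σ_v inv_v : H²(Gal(E/F), J_E) →+ ℚ/ℤ`, `brauerToIdele`).
Theorems only; NO definition, NO named fact, no `sorry`, no instance, no notation; number fields in `Type`.

For a finite Galois extension of number fields `E/F`, Tate (C–F VII §11.2) defines `inv : H²(G, J_E) → ℚ/ℤ` as the
sum of the local invariants and proves the RECIPROCITY LAW `inv ∘ H²(Eˣ → J_E) = 0` (loc. cit. (bis), from §9.6/§10: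
the sum of the local invariants of a global Brauer class vanishes), which makes `inv` descend to `H²(G, C_E)` along
`H²(J_E) → H²(C_E)` — the invariant map of the global class formation.  The tree proved the reciprocity law in the
ABSOLUTE dialect, for THE invariant maps `LocalInvariants.canonical F n` on `H²(Γ_F, μₙ)` and every number field `F`
(`sumInvLocalizationEqZero_canonical_of_numberField`, file `PoitouTateNumberField`, campaign (F1) of cell bsd-cn100).
This file transports it to door-c5's finite-layer `inv E` through the dictionary of
`IdeleBrauerLocalInvariantsDictionary` (door-c6 g12) and Kummer theory:

* §1 `kummer_injective`, **`exists_kummer_eq_of_nsmul_eq_zero`** — `H²(Γ_K, μₙ) ⥲ Br(K)[n]` for EVERY field `K`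
  (Hilbert 90; the tree's `kummerTwoOntoTorsion_holds` proof, which was stated for local fields only);
  `natCard_nsmul_unitsAbsInfTwo_eq_zero` (`[E:F] · inf β = 0`), `exists_kummer_eq_unitsAbsInfTwo`.
* §2 **`localInv_brauerToIdele_eq_canonical`**: for `c ∈ H²(Γ_F, μₙ)` with Kummer image `inf β`,
  door-c5's `localInv E v (brauerToIdele β) = (1/n) · inv_v (loc_v c)` with `inv_v = LocalInvariants.canonical F n v`
  at every FINITE place (dictionary + `cohomologyMap_kummerι_resMu` + `brauerInvariantEquiv_kummer` +
  `localInvariantMap_localization`); `localInv_brauerToIdele_eq_zero_iff`.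
* §3 complex places carry no invariant on either side (`localInvInf_eq_zero_of_isComplex`,
  `LocalInvariants.canonical_inl_eq_zero_of_isComplex`), hence for `F` TOTALLY COMPLEX:
  **`inv_brauerToIdele_eq_zero_of_isTotallyComplex`** — `inv E (brauerToIdele β) = 0` for every
  `β ∈ H²(Gal(E/F), Eˣ)`, and `invHom_comp_brauerToIdele_eq_zero`.

Scope.  The case of a base field `F` with real places needs in addition the archimedean dictionary
(door-c5's `localInvInfAt w₀` = `zmodToQmodZ ∘ archimedeanInvariantMap` on the localisation), not done here;
totally complex `F` covers every layer over an imaginary quadratic field (the base of the cell's crux).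
HONEST FRAMING: classical class field theory (Tate 1967); proves no case of BSD; it is the (A4) input
"`inv` descends to `H²(G, C_E)`" of Route A for crux `AnticycControlAdditiveK` (FINDING-door-c6-g11 §2).

## References
* J. W. S. Cassels, A. Fröhlich (eds.), *Algebraic Number Theory* (1967), Ch. VII (J. Tate) §9.6, §10, §11.2 (and
  (bis)). [CasselsFrohlichANT1967]
* J. Neukirch, A. Schmidt, K. Wingberg, *Cohomology of Number Fields*, 2nd ed. (2008), Thm. (8.1.17)
  (Hasse–Brauer–Noether / Albert: `0 → Br(K) → ⊕ Br(K_v) → ℚ/ℤ → 0`). [NeukirchSchmidtWingberg2008]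
* J.-P. Serre, *Galois Cohomology* (1997), Ch. II §1.2 (Kummer theory). [SerreGaloisCohomology1997]
-/

noncomputable section

open NumberField IsDedekindDomain CategoryTheory groupCohomology Function Field
open Literature.NumberTheory.Automorphic

namespace Literature.NumberTheory.GaloisRepresentations

open DiscreteGaloisModule Literature.AnabelianGeometry.AbsoluteAnabelian.Prop121vii
open Literature.NumberTheory.GaloisCohomology Literature.Algebra.Homology

/-! ## §1. Kummer: `H²(Γ_K, μₙ) ⥲ Br(K)[n]` for every field; the inflated class is `[E:F]`-torsion -/

section Kummer

variable (K : Type) [Field K] (n : ℕ) [NeZero n]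

/-- **Kummer injectivity `H²(Γ_K, μₙ) ↪ H²(Γ_K, K̄ˣ)`** for every field `K` (Hilbert 90).
[cite: SerreGaloisCohomology1997, Ch. II §1.2] -/
theorem kummer_injective : Injective (cohomologyMap (kummerι K n) 2) := by
  haveI : CompactSpace (absoluteGaloisGroup K) := absoluteGaloisGroup_compactSpace K
  have h := isSES_kummer K n (NeZero.pos n)
  have h90 : Subsingleton (continuousCohomology 1 (units K).toTopRep) :=
    subsingleton_galoisCohomology_units_one_holds K
  refine (injective_iff_map_eq_zero _).2 fun z hz => ?_
  obtain ⟨x, rfl⟩ := h.exists_δ₁_eq_of_map_two_eq_zero z hz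
  rw [Subsingleton.elim x 0, map_zero]

/-- **Kummer surjectivity onto the `n`-torsion: every `z ∈ Br(K)` with `n · z = 0` is the Kummer image of a class of
`H²(Γ_K, μₙ)`**, for every field `K` (the `n`-th power map on `K̄ˣ` induces multiplication by `n` on `H²`).
[cite: SerreGaloisCohomology1997, Ch. II §1.2] -/
theorem exists_kummer_eq_of_nsmul_eq_zero (z : galoisCohomology (units K) 2) (hz : (n : ℤ) • z = 0) :
    ∃ x : galoisCohomology (mu K n) 2, cohomologyMap (kummerι K n) 2 x = z := by
  haveI : CompactSpace (absoluteGaloisGroup K) := absoluteGaloisGroup_compactSpace K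
  refine (isSES_kummer K n (NeZero.pos n)).exists_map_two_eq_of_map_two_eq_zero z ?_
  rw [show cohomologyMap (kummerπ K n) 2 z = (n : ℤ) • z from
    Literature.AnabelianGeometry.AbsoluteAnabelian.Prop121vii.cohomologyMap_kummerπ_two K n z]
  exact hz

end Kummer

namespace IdeleCohomology

variable {F : Type} [Field F] [NumberField F] {E : Type} [Field E] [NumberField E] [Algebra F E] [IsGalois F E]

/-- **`#Gal(E/F) · inf β = 0`**: the inflation of a relative Brauer class to `Br(F)` is killed by the degree
(`Hⁿ⁺¹` of a finite group is killed by its order). [cite: CasselsFrohlichANT1967, Ch. VII §11.2] -/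
theorem natCard_zsmul_unitsAbsInfTwo_eq_zero (β : groupCohomology (Rep.ofAlgebraAutOnUnits F E) 2) :
    (Nat.card (E ≃ₐ[F] E) : ℤ) • unitsAbsInfTwo F E β = 0 := by
  rw [natCast_zsmul, ← map_nsmul, card_smul_eq_zero_groupCohomology_succ _ 1 β, map_zero]

/-- **A Kummer preimage of the inflated class**: `inf β = κ(c)` for some `c ∈ H²(Γ_F, μₙ)`, `n = #Gal(E/F)`.
[cite: SerreGaloisCohomology1997, Ch. II §1.2][cite: CasselsFrohlichANT1967, Ch. VII §11.2] -/
theorem exists_kummer_eq_unitsAbsInfTwo [NeZero (Nat.card (E ≃ₐ[F] E))]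
    (β : groupCohomology (Rep.ofAlgebraAutOnUnits F E) 2) :
    ∃ c : galoisCohomology (mu F (Nat.card (E ≃ₐ[F] E))) 2,
      cohomologyMap (kummerι F (Nat.card (E ≃ₐ[F] E))) 2 c = unitsAbsInfTwo F E β :=
  exists_kummer_eq_of_nsmul_eq_zero F _ _ (natCard_zsmul_unitsAbsInfTwo_eq_zero β)

/-! ## §2. The finite-place invariants through THE canonical family -/

variable {n : ℕ} [NeZero n]

/-- `inv_{F_v}` on a Kummer image is `(1/n) · invLevel`, in the `zmodToQmodZ` dialect.
[cite: SerreLocalFields1979, Ch. XIII §3] -/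
theorem brauerInvariantEquiv_kummer_eq_zmodToQmodZ (K : Type) [Field K] [ValuativeRel K] [TopologicalSpace K]
    [IsNonarchimedeanLocalField K] [CharZero K] (y : galoisCohomology (mu K n) 2) :
    brauerInvariantEquiv K (cohomologyMap (kummerι K n) 2 y) = zmodToQmodZ n (invLevel K n y) := by
  rw [zmodToQmodZ_apply]
  exact brauerInvariantEquiv_kummer ⟨n, NeZero.pos n⟩ y

/-- **The finite-place dictionary to THE canonical family**: if `κ(c) = inf β` then door-c5's invariant of `β` at the
finite place `v` is `(1/n) · inv_v (loc_v c)`, `inv_v = LocalInvariants.canonical F n v = localInvariantMap F n v`.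
[cite: CasselsFrohlichANT1967, Ch. VII §7.3 Cor. 7.4 (b)][cite: MilneADT2006, Ch. I §1, Ex. 1.6 (b)] -/
theorem localInv_brauerToIdele_eq_canonical (β : groupCohomology (Rep.ofAlgebraAutOnUnits F E) 2)
    (c : galoisCohomology (mu F n) 2) (hc : cohomologyMap (kummerι F n) 2 c = unitsAbsInfTwo F E β)
    (v : HeightOneSpectrum (𝓞 F)) :
    localInv E v (brauerToIdele F E β) =
      zmodToQmodZ n (LocalInvariants.canonical F n (Sum.inr v)
        (galoisCohomology.localization (mu F n) (Sum.inr v) 2 c)) := by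
  haveI : CharZero (v.adicCompletion F) := charZero_adicCompletion v
  obtain ⟨φ, hφ⟩ := exists_unitsHom (F := F) (v.adicCompletion F)
  rw [localInv_brauerToIdele_eq_brauerInvariantEquiv v φ hφ, LocalInvariants.canonical_inr,
    localInvariantMap_localization, ← brauerInvariantEquiv_kummer_eq_zmodToQmodZ,
    cohomologyMap_kummerι_resMu F (v.adicCompletion F) n φ hφ 2 c]
  change _ = brauerInvariantEquiv (v.adicCompletion F)
    ((ContinuousCohomology.map (absGaloisRestrict F (v.adicCompletion F)) φ 2).hom
      (cohomologyMap (kummerι F n) 2 c))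
  rw [hc]

/-- Corollary: `localInv E v (brauerToIdele β) = 0 ↔ inv_v (loc_v c) = 0` (`zmodToQmodZ` is injective).
[cite: CasselsFrohlichANT1967, Ch. VII §7.3 Cor. 7.4 (b)] -/
theorem localInv_brauerToIdele_eq_zero_iff (β : groupCohomology (Rep.ofAlgebraAutOnUnits F E) 2)
    (c : galoisCohomology (mu F n) 2) (hc : cohomologyMap (kummerι F n) 2 c = unitsAbsInfTwo F E β)
    (v : HeightOneSpectrum (𝓞 F)) :
    localInv E v (brauerToIdele F E β) = 0 ↔
      LocalInvariants.canonical F n (Sum.inr v) (galoisCohomology.localization (mu F n) (Sum.inr v) 2 c) = 0 := by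
  rw [localInv_brauerToIdele_eq_canonical β c hc v, ← map_zero (zmodToQmodZ n), (zmodToQmodZ_injective n).eq_iff]

/-! ## §3. Complex places; the reciprocity law over a totally complex base -/

/-- At a COMPLEX place `v` of `F` door-c5's invariant vanishes: the decomposition group of a place above `v` is
trivial (`n_v = 1`, Mathlib `isUnramified_iff_card_stabilizer_eq_one`) and `n_v · inv_v = 0`.
[cite: CasselsFrohlichANT1967, Ch. VII §7.3 Cor. 7.4 (b)] -/
theorem localInvInf_eq_zero_of_isComplex {v : InfinitePlace F} (hv : v.IsComplex)
    (c : groupCohomology (IdeleClassGroup.ideleRep F E) 2) : localInvInf E v c = 0 := by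
  have h1 : infLocalDegree E v = 1 := by
    rw [infLocalDegree]
    refine (InfinitePlace.isUnramified_iff_card_stabilizer_eq_one (k := F)).1 ?_
    rw [InfinitePlace.isUnramified_iff]
    right
    rw [show (ArchHerbrand.placeOver E v).comap (algebraMap F E) = v from ArchHerbrand.isOver_placeOver (E := E) v]
    exact hv
  have h := infLocalDegree_nsmul_localInvInf (E := E) v c
  rwa [h1, one_smul] at h

/-- **TATE'S RECIPROCITY LAW AT A FINITE LAYER (totally complex base): the local invariants of a relative Brauer
class sum to zero**, `inv E (H²(Eˣ → J_E) β) = 0` for every `β ∈ H²(Gal(E/F), Eˣ)` — from the tree's absolute law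
`Σ_v inv_v (loc_v c) = 0` on `H²(Γ_F, μₙ)` for THE canonical invariant maps, through Kummer and the dictionary.
[cite: CasselsFrohlichANT1967, Ch. VII §11.2 (bis)][cite: NeukirchSchmidtWingberg2008, Thm. (8.1.17)] -/
theorem inv_brauerToIdele_eq_zero_of_isTotallyComplex [IsTotallyComplex F]
    (β : groupCohomology (Rep.ofAlgebraAutOnUnits F E) 2) : inv E (brauerToIdele F E β) = 0 := by
  classical
  obtain ⟨n, hn⟩ : ∃ n : ℕ, n = Nat.card (E ≃ₐ[F] E) := ⟨_, rfl⟩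
  haveI : NeZero n := ⟨by rw [hn]; exact Nat.card_pos.ne'⟩
  have hz : (n : ℤ) • unitsAbsInfTwo F E β = 0 := by rw [hn]; exact natCard_zsmul_unitsAbsInfTwo_eq_zero β
  obtain ⟨c, hc⟩ := exists_kummer_eq_of_nsmul_eq_zero F n _ hz
  -- finite support of door-c5's invariants and the corresponding set of places
  obtain ⟨T, hT⟩ := exists_finset_forall_localInv_eq_zero (E := E) (brauerToIdele F E β)
  have hzero : ∀ v : Place F, v ∉ (Finset.univ : Finset (InfinitePlace F)).disjSum T →
      LocalInvariants.canonical F n v (galoisCohomology.localization (mu F n) v 2 c) = 0 := by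
    rintro (w | v) hv
    · exact absurd (Finset.inl_mem_disjSum.2 (Finset.mem_univ w)) hv
    · have hvT : v ∉ T := fun h => hv (Finset.inr_mem_disjSum.2 h)
      exact (localInv_brauerToIdele_eq_zero_iff β c hc v).1 (hT v hvT)
  have hsum := sumInvLocalizationEqZero_canonical_of_numberField (K := F) n c _ hzero
  rw [Finset.sum_disjSum] at hsum
  have hinf : ∑ w : InfinitePlace F, LocalInvariants.canonical F n (Sum.inl w)
      (galoisCohomology.localization (mu F n) (Sum.inl w) 2 c) = 0 :=
    Finset.sum_eq_zero fun w _ => LocalInvariants.canonical_inl_eq_zero_of_isComplex (IsTotallyComplex.isComplex w) _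
  rw [hinf, zero_add] at hsum
  -- door-c5's `inv` as the same finite sum
  rw [inv_eq_sum (brauerToIdele F E β) T hT, Finset.sum_eq_zero (s := Finset.univ)
    (fun w _ => localInvInf_eq_zero_of_isComplex (IsTotallyComplex.isComplex w) _), add_zero]
  simp_rw [localInv_brauerToIdele_eq_canonical β c hc]
  rw [← map_sum, hsum, map_zero]

/-- **`inv ∘ H²(Eˣ → J_E) = 0`** as additive maps (totally complex base): `inv` vanishes on the image of
`Br(E/F)` in `H²(G, J_E)` and hence descends along `H²(G, J_E) → H²(G, C_E)` (next file).
[cite: CasselsFrohlichANT1967, Ch. VII §11.2 (bis)] -/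
theorem invHom_comp_brauerToIdele_eq_zero [IsTotallyComplex F] :
    (invHom (F := F) (E := E)).comp (brauerToIdele F E).hom.toAddMonoidHom = 0 :=
  AddMonoidHom.ext fun β => inv_brauerToIdele_eq_zero_of_isTotallyComplex β

/-- Element form: every class in the image of `Br(E/F) → H²(G, J_E)` has `inv = 0` (totally complex base).
[cite: CasselsFrohlichANT1967, Ch. VII §11.2 (bis)] -/
theorem inv_eq_zero_of_mem_range_brauerToIdele [IsTotallyComplex F]
    {x : groupCohomology (IdeleClassGroup.ideleRep F E) 2} (hx : x ∈ Set.range (brauerToIdele F E)) :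
    inv E x = 0 := by
  obtain ⟨β, rfl⟩ := hx
  exact inv_brauerToIdele_eq_zero_of_isTotallyComplex β

end IdeleCohomology

end Literature.NumberTheory.GaloisRepresentations

end
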